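import Summits.BirchSwinnertonDyer.BirchSwinnertonDyer.Theorems.EisensteinPrimesSplitMultCharImprimitiveShift
import Summits.BirchSwinnertonDyer.BirchSwinnertonDyer.Theorems.EisensteinPrimesAcTwistDeformationLocSurjOfSurC
import Literature.NumberTheory.GaloisCohomology.TateGlobalEulerCharacteristicTotallyComplex
import HarnessLib

/-!
# Crux 4 `BSDpOnCellC` (stmt-BirchSwinnertonDyer-19034) — «OfSurC» re-typing, file 3: the imprimitive → primitive `λ`-shift of the two
# residual characters at a SPLIT multiplicative Eisenstein prime (`SplitMultCharImprimitiveShift`, Keller–Yin / CGLS Prop. 1.2.5) with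
# Greenberg 2016 Prop. 2.6.3 BY NAME ↦ its CASE (c) AT TOTALLY COMPLEX FIELDS BY NAME (`prop263_sur_of_crk_caseC_tc`)

Cell `bsd-eis` (run/shared/lean/pub/bsd-eis/), width seat `bsd-line-x2-p2` gen 16; `--supports stmt-BirchSwinnertonDyer-19034`
(helper; closes nothing; skeleton of record crystal v10 UNCHANGED, W-79). Sequel of `…SplitMultLambdaLEOfSurC` (module docstring there:
why the crux-4-side consumers of `prop263_sur_of_crk` are re-typed onto the case-(c)-TC statement that crux 2 and road «SUR-Λ» read).

WHAT. The two `h263`-theorems of `EisensteinPrimesSplitMultCharImprimitiveShift` re-typed: `(h263 : prop263_sur_of_crk_caseC_tc)`, names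
`<name>_ofSurC`, the road-(A) leaf `AcTwistDeformation.exists_mem_unrSelmer_forall_resOfLe_conjH1_eq` replaced by x1-w5's
`…_ofSurC` twin.  That twin reads Greenberg 2006 Prop. 3.2 only in the shape «Tate's global Euler–Poincaré characteristic at totally
complex fields», a TREE THEOREM (`GaloisCohomology.forall_tateGlobalEulerPoincareCharacteristic_of_isTotallyComplex`) supplied inside the
proof — so the binder `(h32 : prop32_cohomology_isCofinitelyGenerated)` of the originals is DROPPED (it would be idle); all other binders,
their order and the conclusions are VERBATIM.  The §0 bookkeeping lemmas are used from the re-typed file unchanged.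
* `sum_charLocalLambda_le_zpCorank_unrSelmer_quotient_of_split_ofSurC` — road (A), `Σ_{w∈Sf} λ𝒫_w(θ) ≤ corank_{ℤ_p}(H¹_{𝓕_nr^{Sf}}/H¹_{𝓕_nr})`.
* `imprimitive_clauses_of_split_ofSurC` — the Prop. 1.2.5 package: every imprimitive dual datum is f.g. torsion, `μ = 0`,
  `λ(DS.X) = λ(D.X) + Σ_{w∈Sf} λ𝒫_w(θ)`.

HONEST FRAMING: theorems only (0 defs, 0 named facts, 0 sorry, 0 instances); CONDITIONAL on the published named facts carried as
hypotheses; closes no stub; no summit statement / BSD / MC / IMC / Keller–Yin theorem is proved for any curve; 0 cells / labels / tiers move.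

References: [KellerYin2024] Prop. 1.2.5 (eq:Gr to imp), Rem. 1.2.3 (ii), §5.1 (arXiv:2402.12781v2); [CastellaGrossiLeeSkinner2022] Prop. 1.2.5
and proof; [Greenberg2016Selmer] Prop. 2.6.3 (c); [Greenberg2010] Prop. 3.2.1 (c); [MilneADT2006] I Thm. 5.1; [Greenberg2006] Props. 4.1, 4.2,
§5 A; [PollackWeston2011] App. A Prop. A.2; [GreenbergVatsal2000] §2 Cor. (2.3), Prop. (2.4); [Brink2007] Thm. 2.
-/

set_option autoImplicit false
set_option linter.dupNamespace false

noncomputable section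

open scoped Classical
open NumberField IsDedekindDomain Field Multiplicative PowerSeries WeierstrassCurve
open Literature.NumberTheory.EllipticCurves Literature.NumberTheory.EllipticCurves.GreenbergSelmer
  Literature.NumberTheory.EllipticCurves.GreenbergVatsal2000 Literature.NumberTheory.GaloisRepresentations
  Literature.NumberTheory.EllipticCurves.KellerYin2024 Literature.NumberTheory.EllipticCurves.IwasawaDual
  Literature.NumberTheory.IwasawaTheory Literature.NumberTheory.IwasawaTheory.Greenberg2016
  Literature.NumberTheory.IwasawaTheory.Greenberg2006 Literature.NumberTheory.EllipticCurves.Castella2018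
  Summit.BirchSwinnertonDyer.BirchSwinnertonDyer.Theorems
  Summit.BirchSwinnertonDyer.BirchSwinnertonDyer.Theorems.GreenbergFullAtSelmer
  Summit.BirchSwinnertonDyer.BirchSwinnertonDyer.Theorems.AcTwistDeformationResidualPair
  Summit.BirchSwinnertonDyer.BirchSwinnertonDyer.Theorems.UnrSelmerQuotientTorsionFiniteChar
  Summit.BirchSwinnertonDyer.BirchSwinnertonDyer.Theorems.AcTwistDeformation

namespace Summit.BirchSwinnertonDyer.BirchSwinnertonDyer.Theorems.SplitMultCharImprimitiveShift

/-! ## §1. Road (A) at the SPLIT datum, «OfSurC» -/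

section RoadA

variable {K : Type} [Field K] [NumberField K] {p : ℕ} [hp : Fact p.Prime]

/-- **[«OfSurC» re-typing: Greenberg 2016 Prop. 2.6.3 by name ↦ its case (c) at totally complex `K` by name (`prop263_sur_of_crk_caseC_tc`);
binder `h32` dropped (Prop. 3.2 enters only as Tate's global EPC at totally complex fields, a tree theorem fed inside).]**
**Keller–Yin Prop. 1.2.5 (eq:Gr to imp), `≥` direction, AT A SPLIT MULTIPLICATIVE EISENSTEIN PRIME** — `sum_charLocalLambda_le_zpCorank_unrSelmer_quotient_of_split`
otherwise VERBATIM: `Σ_{w∈Sf} charLocalLambda ∅ κ θ w ≤ corank_{ℤ_p}(H¹_{𝓕_nr^{Sf}}/H¹_{𝓕_nr})` for `θ ∈ {θsub, θquot}` under [RH], the road-(A) leaf being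
`AcTwistDeformation.exists_mem_unrSelmer_forall_resOfLe_conjH1_eq_ofSurC`.
[cite: KellerYin2024, Prop. 1.2.5 (eq:Gr to imp), Rem. 1.2.3 (ii), §5.1 (arXiv:2402.12781v2 TeX L780–800, L690–712, L1725–1769)]
[cite: Greenberg2016Selmer, Prop. 2.6.3 (c) (§2.6 p. 10)] [cite: Greenberg2010, Prop. 3.2.1 (c) (p. 15)] [cite: MilneADT2006, I Thm. 5.1 (p. 67)]
[cite: Greenberg2006, Props. 4.1, 4.2, §5 A] [cite: PollackWeston2011, App. A Prop. A.2] -/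
theorem sum_charLocalLambda_le_zpCorank_unrSelmer_quotient_of_split_ofSurC (h263 : prop263_sur_of_crk_caseC_tc)
    (h41 : prop41_globalEulerPoincareCorank) (h42 : prop42_localEulerPoincareCorank)
    (h5A : sec5A_localH2_subsingleton_of_LOC1)
    (W : WeierstrassCurve ℚ) [W.IsElliptic] [W.IsGloballyMinimal] (hp : 2 < p)
    (hsplitred : W.HasSplitMultiplicativeReductionAtPrime p) (hK : IsImaginaryQuadratic K)
    (hH : SatisfiesHeegnerHypothesis (W.conductorNorm ℤ) K)
    {ι : K →+* ℚ_[p]} {v vbar : HeightOneSpectrum (𝓞 K)} (hvι : ∀ x : 𝓞 K, x ∈ v.asIdeal ↔ ‖ι (x : K)‖ < 1)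
    (hvbar : ((p : ℕ) : 𝓞 K) ∈ vbar.asIdeal) (hne : vbar ≠ v)
    (κ : ZpExtension K p) (hκ : κ.IsAnticyclotomic) (γ : absoluteGaloisGroup K) [Fact (κ.IsTopGenerator γ)]
    {θsub θquot : FramedGaloisRep K (padicCoeffIntegers (∅ : Set (PadicAlgCl p))) 1}
    (hpair : IsResidualPairOver (W.baseChange K) p θsub θquot)
    (Sf : Finset (HeightOneSpectrum (𝓞 K)))
    (hSf : ∀ w : HeightOneSpectrum (𝓞 K), w ∈ Sf ↔
      (((W.conductorNorm ℤ : ℤ) : 𝓞 K) ∈ w.asIdeal ∧ ((p : ℕ) : 𝓞 K) ∉ w.asIdeal))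
    (θ : FramedGaloisRep K (padicCoeffIntegers (∅ : Set (PadicAlgCl p))) 1) (hθ : θ = θsub ∨ θ = θquot)
    (hRH : ∀ D : DatumDualData κ γ (charModule ∅ θ)
        (AcSelmer.bdpData (charModule ∅ θ) p vbar) (∅ : Set (HeightOneSpectrum (𝓞 K))),
      Module.Finite (IwasawaAlgebra p) D.X ∧ Module.IsTorsion (IwasawaAlgebra p) D.X ∧ muInvariant p D.X = 0) :
    ∑ w ∈ Sf, charLocalLambda ∅ κ θ w ≤
      zpCorank (↥(unrSelmer κ (charModule ∅ θ) vbar (↑Sf : Set (HeightOneSpectrum (𝓞 K)))) ⧸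
        (unrSelmer κ (charModule ∅ θ) vbar (∅ : Set (HeightOneSpectrum (𝓞 K)))).addSubgroupOf
          (unrSelmer κ (charModule ∅ θ) vbar (↑Sf : Set (HeightOneSpectrum (𝓞 K))))) p := by
  have hγ : κ.IsTopGenerator γ := Fact.out
  have hT : ∀ (L : Type) [Field L] [NumberField L] [IsTotallyComplex L],
      Literature.NumberTheory.GaloisCohomology.tateGlobalEulerPoincareCharacteristic L :=
    Literature.NumberTheory.GaloisCohomology.forall_tateGlobalEulerPoincareCharacteristic_of_isTotallyComplex
  have hv : ((p : ℕ) : 𝓞 K) ∈ v.asIdeal := IwasawaTwoVariable.natCast_mem_asIdeal_of_norm_iff hvι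
  -- the prime-to-`p` part of the conductor: line b1's `Sf` is the set of places over it
  have hN0 : W.conductorNorm ℤ ≠ 0 := (W.conductorNorm_pos_holds).ne'
  set N' : ℕ := W.conductorNorm ℤ / p ^ (W.conductorNorm ℤ).factorization p with hN'def
  have hH' : SatisfiesHeegnerHypothesis N' K := hH.of_dvd (Nat.ordCompl_dvd (W.conductorNorm ℤ) p)
  have hSf' : ∀ w : HeightOneSpectrum (𝓞 K), w ∈ Sf ↔ ((N' : ℤ) : 𝓞 K) ∈ w.asIdeal := fun w ↦ by
    rw [hSf, hN'def, intCast_ordCompl_mem_iff hN0]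
  have hSfp : ∀ w ∈ Sf, ((p : ℕ) : 𝓞 K) ∉ w.asIdeal := fun w hw ↦ ((hSf w).mp hw).2
  have hSp : ∀ w : HeightOneSpectrum (𝓞 K), ((p : ℕ) : 𝓞 K) ∈ w.asIdeal → w = v ∨ w = vbar :=
    fun w hw ↦ eq_or_eq_of_natCast_mem_of_ne hK.1 hv hvbar hne hw
  have hθpow : ∀ σ : absoluteGaloisGroup K, θ σ ^ (p - 1) = 1 := fun σ ↦ by
    rcases hθ with rfl | rfl
    · exact (hpair.pow_sub_one σ).1
    · exact (hpair.pow_sub_one σ).2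
  -- every `w ∈ Sf` is finitely decomposed in `K_∞^{ac}` (Brink), with `κ(D_w) = p^{a_w} ℤ_p` exactly
  have hdec : ∀ w ∈ Sf, ¬ decomp (K := K) w ≤ κ.kerSubgroup := fun w hw hle ↦ by
    obtain ⟨δ, hδ, hne1⟩ := exists_mem_decomp_apply_ne_one_of_heegner hK hp hH' κ hκ w ((hSf' w).mp hw)
      (hSfp w hw)
    exact hne1 (ZpExtension.mem_kerSubgroup.mp (hle hδ))
  have hexp : ∀ w : HeightOneSpectrum (𝓞 K), ∃ a : ℕ, w ∈ Sf →
      (∃ δ ∈ decomp (K := K) w, (κ δ).toAdd = (p : ℤ_[p]) ^ a) ∧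
        ∀ δ ∈ decomp (K := K) w, (p : ℤ_[p]) ^ a ∣ (κ δ).toAdd := by
    intro w
    by_cases hw : w ∈ Sf
    · obtain ⟨c, ⟨d₀, hd₀⟩, -, hdvd⟩ :=
        UniversalToricDescentSigmaLocalStabilizer.exists_pow_and_forall_dvd_of_not_le κ w (hdec w hw)
      exact ⟨c, fun _ ↦ ⟨⟨d₀, d₀.2, hd₀⟩, fun δ hδ ↦ hdvd ⟨δ, hδ⟩⟩⟩
    · exact ⟨0, fun h ↦ (hw h).elim⟩
  choose a ha using hexp
  have hd₀ : ∀ w ∈ Sf, ∃ δ ∈ decomp (K := K) w, (κ δ).toAdd = (p : ℤ_[p]) ^ a w :=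
    fun w hw ↦ (ha w hw).1
  have hdiv : ∀ w ∈ Sf, ∀ δ ∈ decomp (K := K) w, (p : ℤ_[p]) ^ a w ∣ (κ δ).toAdd :=
    fun w hw ↦ (ha w hw).2
  -- the representatives `γ^i` of the places above `w`: `κ(γ^i) = i`
  have hσrep : ∀ w ∈ Sf, ∀ i : ℕ, i < p ^ a w → (κ ((fun (_ : HeightOneSpectrum (𝓞 K)) (i : ℕ) ↦ γ ^ i) w i)).toAdd =
      (i : ℤ_[p]) := fun w _ i _ ↦ by
    change (κ (γ ^ i)).toAdd = (i : ℤ_[p])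
    rw [map_pow, show κ γ = Multiplicative.ofAdd 1 from hγ, ← ofAdd_nsmul, toAdd_ofAdd, nsmul_one]
  -- `S = {v, v̄} ∪ Sf` = the places over `N_W`; `θ` is unramified outside `S`
  have hS : ∀ w : HeightOneSpectrum (𝓞 K), ((p : ℕ) : 𝓞 K) ∈ w.asIdeal →
      w ∈ (↑(insert v (insert vbar Sf)) : Set (HeightOneSpectrum (𝓞 K))) :=
    mem_insert_insert_of_natCast_mem hK hv hvbar hne Sf
  have hSfS : ∀ w ∈ Sf, w ∈ (↑(insert v (insert vbar Sf)) : Set (HeightOneSpectrum (𝓞 K))) :=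
    fun w hw ↦ by
    rw [Finset.coe_insert, Finset.coe_insert]
    exact Or.inr (Or.inr (Finset.mem_coe.mpr hw))
  have hSN : ∀ w : HeightOneSpectrum (𝓞 K), w ∈ insert v (insert vbar Sf) ↔ ((W.conductorNorm ℤ : ℤ) : 𝓞 K) ∈ w.asIdeal :=
    mem_insert_insert_iff_conductorNorm_mem W hsplitred hK hv hvbar hne Sf hSf
  have h : ramificationSubgroup K (↑(insert v (insert vbar Sf)) : Set (HeightOneSpectrum (𝓞 K))) ≤
      (unitChar θ).toMonoidHom.ker :=
    ramificationSubgroup_le_ker_unitChar_of_residualPair W hpair (insert v (insert vbar Sf)) hSN _ (fun _ hw ↦ hw) hS θ hθ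
  -- the canonical (discrete) topological instances of the model
  letI tΛ : TopologicalSpace (PowerSeries ℤ_[p]) := ⊥
  haveI : DiscreteTopology (PowerSeries ℤ_[p]) := ⟨rfl⟩
  haveI : IsTopologicalRing (PowerSeries ℤ_[p]) := inferInstance
  haveI hAdisc : DiscreteTopology (QpModZp p) := QpModZp.discreteTopology p
  haveI : IsTopologicalAddGroup (BigRepModule ℤ_[p] p (QpModZp p)) := inferInstance
  haveI : ContinuousSMul (PowerSeries ℤ_[p]) (BigRepModule ℤ_[p] p (QpModZp p)) := inferInstance
  -- the model `ρ_θ` on `ℚ_p/ℤ_p`, `ψ = (charModuleEquiv θ)⁻¹`, the Shapiro descent `F`, and [RH]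
  have hψ := charModuleEquiv_symm_galois (↑(insert v (insert vbar Sf)) : Set (HeightOneSpectrum (𝓞 K))) θ h
  obtain ⟨F, hF⟩ := exists_shapiroDescent _ hS κ (characterRepUnramified _ θ h) (charModuleEquiv θ).symm hψ
  obtain ⟨hSel, hSelfg⟩ := hasCorank_fullAtSelmer_zero_of_RH hK κ hγ hv hvbar hne θ _ hS h hRH
  -- the `K_∞`-side global-to-local surjectivity at the places of `Sf` (all off `p`)
  have h8 : ∀ y : ∀ w : HeightOneSpectrum (𝓞 K), ℕ →
      subgroupH1 (κ.kerSubgroup ⊓ decomp (K := K) w) (charModule (∅ : Set (PadicAlgCl p)) θ),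
      ∃ u ∈ unrSelmer κ (charModule (∅ : Set (PadicAlgCl p)) θ) vbar (↑Sf : Set (HeightOneSpectrum (𝓞 K))),
        ∀ w ∈ Sf, ∀ i : ℕ, i < p ^ a w →
          resOfLe (charModule (∅ : Set (PadicAlgCl p)) θ)
            (inf_le_left : κ.kerSubgroup ⊓ decomp (K := K) w ≤ κ.kerSubgroup)
            (conjH1 κ.kerSubgroup (charModule (∅ : Set (PadicAlgCl p)) θ) (γ ^ i) u) = y w i := fun y ↦
    exists_mem_unrSelmer_forall_resOfLe_conjH1_eq_ofSurC _ hS κ (characterRepUnramified _ θ h)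
      (charModuleEquiv θ).symm hψ h263 h41 h42 h5A hT (Finset.finite_toSet _) hK
      (LinearEquiv.refl ℤ_[p] (QpModZp p)) (characterRepUnramified_hscalar _ θ h)
      (fun w hw ↦ exists_local_apply_ne_one_of_mem_insert_insert hK hp hH κ hκ hv hvbar (insert v (insert vbar Sf)) hSN w
        (by rw [Finset.coe_insert, Finset.coe_insert]; exact Or.inr (Or.inr hw)))
      hne hv hvbar hSp hSel hSelfg (fun b ↦ QpModZp.exists_pow_nsmul_eq_zero b) hF Sf hSfS hSfp a hdiv hd₀
      (fun _ i ↦ γ ^ i) hσrep y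
  -- corank bookkeeping (x1-p1-w2's adapter, generic core)
  exact UnrSelmerLocSurjAdapter.sum_charLocalLambda_le_zpCorank_unrSelmer_quotient_of_forall_exists κ θ vbar Sf hθpow hγ hSfp
    (fun w hw ↦ exists_mem_decomp_apply_ne_one_of_heegner hK hp hH' κ hκ w ((hSf' w).mp hw) (hSfp w hw)) a hdiv hd₀
    (fun _ i ↦ γ ^ i) hσrep h8

end RoadA

/-! ## §2. The Prop. 1.2.5 package at the split datum, «OfSurC» -/

section Package

variable {K : Type} [Field K] [NumberField K] {p : ℕ} [hp : Fact p.Prime]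

/-- **[«OfSurC» re-typing: Greenberg 2016 Prop. 2.6.3 by name ↦ its case (c) at totally complex `K` by name (`prop263_sur_of_crk_caseC_tc`);
binder `h32` dropped.]** **Keller–Yin / CGLS Prop. 1.2.5 for the residual characters AT A SPLIT MULTIPLICATIVE EISENSTEIN PRIME** —
`imprimitive_clauses_of_split` otherwise VERBATIM: for every imprimitive unramified dual datum `DS` over line b1's `Sf` and every primitive `D`,
`DS.X` is f.g. `Λ`-torsion with `μ = 0` and `λ(DS.X) = λ(D.X) + Σ_{w∈Sf} λ𝒫_w(θ)` (§1 + the tree's `≤` half, torsion finiteness and GV Cor. (2.3)).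
[cite: KellerYin2024, Prop. 1.2.5 and proof (arXiv:2402.12781v2 TeX L780–800)] [cite: CastellaGrossiLeeSkinner2022, Prop. 1.2.5 and proof]
[cite: GreenbergVatsal2000, §2 Cor. (2.3) (pp. 20–21)] [cite: Greenberg2016Selmer, Prop. 2.6.3 (c)] [cite: Greenberg2010, Prop. 3.2.1 (c) (p. 15)] -/
theorem imprimitive_clauses_of_split_ofSurC (h263 : prop263_sur_of_crk_caseC_tc)
    (h41 : prop41_globalEulerPoincareCorank) (h42 : prop42_localEulerPoincareCorank)
    (h5A : sec5A_localH2_subsingleton_of_LOC1)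
    (W : WeierstrassCurve ℚ) [W.IsElliptic] [W.IsGloballyMinimal] (hp : 2 < p)
    (hsplitred : W.HasSplitMultiplicativeReductionAtPrime p) (hK : IsImaginaryQuadratic K)
    (hH : SatisfiesHeegnerHypothesis (W.conductorNorm ℤ) K)
    {ι : K →+* ℚ_[p]} {v vbar : HeightOneSpectrum (𝓞 K)} (hvι : ∀ x : 𝓞 K, x ∈ v.asIdeal ↔ ‖ι (x : K)‖ < 1)
    (hvbar : ((p : ℕ) : 𝓞 K) ∈ vbar.asIdeal) (hne : vbar ≠ v)
    (κ : ZpExtension K p) (hκ : κ.IsAnticyclotomic) (γ : absoluteGaloisGroup K) [Fact (κ.IsTopGenerator γ)]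
    {θsub θquot : FramedGaloisRep K (padicCoeffIntegers (∅ : Set (PadicAlgCl p))) 1}
    (hpair : IsResidualPairOver (W.baseChange K) p θsub θquot)
    (Sf : Finset (HeightOneSpectrum (𝓞 K)))
    (hSf : ∀ w : HeightOneSpectrum (𝓞 K), w ∈ Sf ↔
      (((W.conductorNorm ℤ : ℤ) : 𝓞 K) ∈ w.asIdeal ∧ ((p : ℕ) : 𝓞 K) ∉ w.asIdeal))
    (θ : FramedGaloisRep K (padicCoeffIntegers (∅ : Set (PadicAlgCl p))) 1) (hθ : θ = θsub ∨ θ = θquot)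
    (hRH : ∀ D : DatumDualData κ γ (charModule ∅ θ)
        (AcSelmer.bdpData (charModule ∅ θ) p vbar) (∅ : Set (HeightOneSpectrum (𝓞 K))),
      Module.Finite (IwasawaAlgebra p) D.X ∧ Module.IsTorsion (IwasawaAlgebra p) D.X ∧ muInvariant p D.X = 0)
    (D : DatumDualData κ γ (charModule ∅ θ) (AcSelmer.bdpData (charModule ∅ θ) p vbar) (∅ : Set (HeightOneSpectrum (𝓞 K))))
    (DS : DatumDualData κ γ (charModule ∅ θ) (AcSelmer.bdpData (charModule ∅ θ) p vbar) (↑Sf : Set (HeightOneSpectrum (𝓞 K)))) :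
    Module.Finite (IwasawaAlgebra p) DS.X ∧ Module.IsTorsion (IwasawaAlgebra p) DS.X ∧ muInvariant p DS.X = 0 ∧
      lambdaInvariant p DS.X = lambdaInvariant p D.X + ∑ w ∈ Sf, charLocalLambda ∅ κ θ w := by
  have hγ : κ.IsTopGenerator γ := Fact.out
  have hN0 : W.conductorNorm ℤ ≠ 0 := (W.conductorNorm_pos_holds).ne'
  set N' : ℕ := W.conductorNorm ℤ / p ^ (W.conductorNorm ℤ).factorization p with hN'def
  have hH' : SatisfiesHeegnerHypothesis N' K := hH.of_dvd (Nat.ordCompl_dvd (W.conductorNorm ℤ) p)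
  have hSf' : ∀ w : HeightOneSpectrum (𝓞 K), w ∈ Sf ↔ ((N' : ℤ) : 𝓞 K) ∈ w.asIdeal := fun w ↦ by
    rw [hSf, hN'def, intCast_ordCompl_mem_iff hN0]
  have hSfp : ∀ w ∈ Sf, ((p : ℕ) : 𝓞 K) ∉ w.asIdeal := fun w hw ↦ ((hSf w).mp hw).2
  -- the corank IDENTITY of the quotient
  have hge := sum_charLocalLambda_le_zpCorank_unrSelmer_quotient_of_split_ofSurC h263 h41 h42 h5A W hp hsplitred hK hH hvι hvbar hne κ
    hκ γ hpair Sf hSf θ hθ hRH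
  have hle := UnrSelmerQuotientCorankLocalLambda.zpCorank_unrSelmer_quotient_le_at_residualPair hK hp hH' κ hκ hγ vbar θsub θquot
    hpair Sf hSf' hSfp θ hθ
  have hcork := le_antisymm hle hge
  -- finiteness of the `p`-torsion of the quotient, and GV Cor. (2.3)
  have hQ := UnrSelmerQuotientTorsionFiniteChar.finite_torsionBy_unrSelmer_quotient hK hp hH' κ hκ hγ vbar θ Sf hSf'
  obtain ⟨hfg, htors, hμ⟩ := hRH D
  haveI := hfg
  obtain ⟨hfgS, htorsS, hμS, hlamS⟩ :=
    UnrSelmerImprimitiveFiniteness.moduleFinite_isTorsion_mu_lambda_of_primitive κ vbar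
      (exists_pow_smul_cofree_eq_zero (∅ : Set (PadicAlgCl p)) θ)
      (isOpen_stabilizer_cofree (∅ : Set (PadicAlgCl p)) θ) hγ
      (Set.empty_subset (↑Sf : Set (HeightOneSpectrum (𝓞 K)))) D htors DS hQ
  exact ⟨hfgS, htorsS, hμS.trans hμ, by rw [hlamS, hcork]⟩

end Package

end Summit.BirchSwinnertonDyer.BirchSwinnertonDyer.Theorems.SplitMultCharImprimitiveShift

end
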